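import Literature.MathematicalPhysics.QuantumLattice.GrassmannGaussianChargeRule
import HarnessLib

/-!
# Renormalisation of the free Gaussian Grassmann integration (absorbing a quadratic term)

Topic `Literature/MathematicalPhysics/QuantumLattice`; a step of the multiscale integration of
Benfatto–Giuliani–Mastropietro 2006, §2.3: the local quadratic part of the effective potential,
`ℒ₂𝒱 = Σ ∫ n_h ψ⁺ψ⁻` ((2.22)), is inserted into the Gaussian integration — the function `E_h` of the
free "measure" is changed to `E_{h-1} = E_h + C_h⁻¹ n̂_h` ((2.23)) at the cost of a constant `t_h`
("a constant which takes into account the change in the renormalization factor of the measure",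
(2.24); Mastropietro 2008, §4: the dressing of the free measure).  In the finite-dimensional
Grassmann algebra this is the elementary identity

`e^{ψ̄Aψ} e^{ψ̄Nψ} = e^{ψ̄(A+N)ψ}`   (`grassmannExp_quadratic_add`)

for the commuting nilpotent quadratic actions, whence for every observable `X`

`∫ e^{ψ̄Aψ} (e^{ψ̄Nψ} X) = ∫ e^{ψ̄(A+N)ψ} X`   (`berezin_grassmannExp_quadratic_mul_grassmannExp_quadratic_mul`)

and, for the normalised expectations over a field,
`⟨e^{ψ̄Nψ} X⟩_A = (det (A+N) / det A) · ⟨X⟩_{A+N}`   (`grassmannGaussian_mul_grassmannExp_quadratic`):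
the quadratic insertion renormalises the covariance and produces the constant `det(A+N)/det A`
(`= e^{-L²β t_h}` in BGM's notation).  Everything is proved; no named fact.

## Sources

G. Benfatto, A. Giuliani, V. Mastropietro, Ann. Henri Poincaré 7 (2006), (2.21)–(2.24)
(`BenfattoGiulianiMastropietro2006`); V. Mastropietro, *Non-Perturbative Renormalization* (2008),
Ch. 2 (2.7) and Ch. 4 (`Mastropietro2008`).
-/

noncomputable section

namespace Literature.MathematicalPhysics.QuantumLattice

open GrassmannAlgebra ExteriorAlgebra

section QLatticeAQFT

variable (R : Type*) [CommRing R] {ι : Type*} [LinearOrder ι] [Fintype ι]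

/-- The quadratic action is additive in the matrix: `ψ̄(A+B)ψ = ψ̄Aψ + ψ̄Bψ`. [folklore] -/
theorem quadratic_add (A B : Matrix ι ι R) : quadratic R (A + B) = quadratic R A + quadratic R B := by
  simp only [quadratic, Matrix.add_apply, add_smul, Finset.sum_add_distrib]

/-- `ψ̄0ψ = 0`. [folklore] -/
@[simp] theorem quadratic_zero : quadratic R (0 : Matrix ι ι R) = 0 := by
  simp [quadratic]

/-- The quadratic action is homogeneous in the matrix. [folklore] -/
theorem quadratic_smul (c : R) (A : Matrix ι ι R) : quadratic R (c • A) = c • quadratic R A := by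
  simp only [quadratic, Matrix.smul_apply, smul_eq_mul, mul_smul, Finset.smul_sum]

/-- `ψ̄(-A)ψ = -ψ̄Aψ`. [folklore] -/
theorem quadratic_neg (A : Matrix ι ι R) : quadratic R (-A) = -quadratic R A := by
  rw [← neg_one_smul R A, quadratic_smul, neg_one_smul]

/-- `ψ̄(A - B)ψ = ψ̄Aψ - ψ̄Bψ`. [folklore] -/
theorem quadratic_sub (A B : Matrix ι ι R) : quadratic R (A - B) = quadratic R A - quadratic R B := by
  rw [sub_eq_add_neg, quadratic_add, quadratic_neg, sub_eq_add_neg]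

/-- The quadratic action is central. [folklore] -/
theorem commute_quadratic (A : Matrix ι ι R) (z : GrassmannAlgebra R (ι ⊕ₗ ι)) : Commute (quadratic R A) z := by
  rw [quadratic]
  exact Commute.sum_left _ _ _ fun i _ => Commute.sum_left _ _ _ fun j _ =>
    (commute_psiBar_mul_psi R i j z).smul_left _

variable [Algebra ℚ R]

/-- **Absorbing a quadratic term into the Gaussian weight**: `e^{ψ̄Aψ} e^{ψ̄Nψ} = e^{ψ̄(A+N)ψ}`
(Benfatto–Giuliani–Mastropietro 2006, (2.23): `E_{h-1} = E_h + C_h⁻¹ n̂_h`). [folklore] -/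
theorem grassmannExp_quadratic_add (A N : Matrix ι ι R) :
    grassmannExp (quadratic R (A + N)) = grassmannExp (quadratic R A) * grassmannExp (quadratic R N) := by
  rw [quadratic_add, grassmannExp, grassmannExp, grassmannExp,
    IsNilpotent.exp_add_of_commute (commute_quadratic R A _) (isNilpotent_quadratic R A) (isNilpotent_quadratic R N)]

/-- **The quadratic insertion renormalises the Gaussian integration**: for every observable `X`,
`∫ dψ̄dψ e^{ψ̄Aψ} (e^{ψ̄Nψ} X) = ∫ dψ̄dψ e^{ψ̄(A+N)ψ} X` (BGM 2006, (2.21)→(2.24)). [folklore] -/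
theorem berezin_grassmannExp_quadratic_mul_grassmannExp_quadratic_mul (A N : Matrix ι ι R)
    (X : GrassmannAlgebra R (ι ⊕ₗ ι)) :
    berezin R (ι ⊕ₗ ι) (grassmannExp (quadratic R A) * (grassmannExp (quadratic R N) * X)) =
      berezin R (ι ⊕ₗ ι) (grassmannExp (quadratic R (A + N)) * X) := by
  rw [grassmannExp_quadratic_add, mul_assoc]

/-- The normalisation of the renormalised Gaussian integration relative to the old one:
`∫ e^{ψ̄Aψ} e^{ψ̄Nψ} = ε det (A + N)` with the same orientation sign `ε` as `∫ e^{ψ̄Aψ} = ε det A`.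
[folklore] -/
theorem berezin_grassmannExp_quadratic_mul_grassmannExp_quadratic (A N : Matrix ι ι R) :
    berezin R (ι ⊕ₗ ι) (grassmannExp (quadratic R A) * grassmannExp (quadratic R N)) =
      (-1 : R) ^ (Fintype.card ι * (Fintype.card ι - 1) / 2) * (A + N).det := by
  rw [← grassmannExp_quadratic_add, berezin_grassmannExp_quadratic_holds R (A + N)]

end QLatticeAQFT

section Field

variable (K : Type*) [Field K] [CharZero K] {ι : Type*} [LinearOrder ι] [Fintype ι]

/-- **The constant produced by the measure change** (BGM 2006, (2.24): `e^{-L²β t_h}`): for the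
normalised expectations `⟨·⟩_A = ∫ e^{ψ̄Aψ}(·) / ∫ e^{ψ̄Aψ}` over a field, `det A ≠ 0`,
`⟨e^{ψ̄Nψ} X⟩_A = (det (A + N) / det A) · ⟨X⟩_{A+N}` whenever `det (A + N) ≠ 0`. [cite: BenfattoGiulianiMastropietro2006, (2.23)-(2.24)] -/
theorem grassmannGaussian_mul_grassmannExp_quadratic (A N : Matrix ι ι K) (hA : A.det ≠ 0)
    (hAN : (A + N).det ≠ 0) (X : GrassmannAlgebra K (ι ⊕ₗ ι)) :
    berezin K (ι ⊕ₗ ι) (grassmannExp (quadratic K A) * (grassmannExp (quadratic K N) * X)) /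
        berezin K (ι ⊕ₗ ι) (grassmannExp (quadratic K A)) =
      (A + N).det / A.det *
        (berezin K (ι ⊕ₗ ι) (grassmannExp (quadratic K (A + N)) * X) /
          berezin K (ι ⊕ₗ ι) (grassmannExp (quadratic K (A + N)))) := by
  have hε : ((-1 : K) ^ (Fintype.card ι * (Fintype.card ι - 1) / 2)) ≠ 0 :=
    pow_ne_zero _ (neg_ne_zero.2 one_ne_zero)
  rw [berezin_grassmannExp_quadratic_mul_grassmannExp_quadratic_mul, berezin_grassmannExp_quadratic_holds K A,
    berezin_grassmannExp_quadratic_holds K (A + N)]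
  field_simp

end Field

end Literature.MathematicalPhysics.QuantumLattice
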